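import Summits.AtomisticToContinuum.BoseEinsteinCondensation.Theses.BECCutLineWeakDisorder
import Summits.AtomisticToContinuum.BoseEinsteinCondensation.Theorems.WitnessTransfer.Negative.LandscapeRatioFloor

/-!
# Disproof attempts for crux `WitnessTransfer` (stmt-AtomisticToContinuum-14978) — findings

Crux (route `BECCutLineWeakDisorder`, rank 5/9):
`WitnessTransfer := TwoReplicaTransienceBound → LandscapeBound` — the ENGINE (two-replica bound on the
finite-`T` Feynman–Kac witnesses `Ψ_T = fkWitness v L T 1`, uniformly in `T ≥ 1` and eventually in `n`)
implies the HINGE (for every `δ > 0` a nonnegative `C¹` `δ`-near-minimiser with landscape ratio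
`R_L(Ψ) = ∫ L³ m²/s² ≤ C`). Seat `refuter-cdisprove-stmt-AtomisticToContinuum-14978-0`, cycle 1
(2026-08-16). VERDICT OF THIS CYCLE: **no kill; the crux resists** — and the lead's line `Sketch`
(Lines/Sketch.lean, stubs B, C, E1a, E1b, F, E2, G) survives an adversarial audit stub by stub (§5).

## Findings (indexed; formal content is sorry-free unless marked NEAR-MISS/INFORMAL)

* §0 SHAPE. `¬ WitnessTransfer ↔ TwoReplicaTransienceBound ∧ ¬ LandscapeBound`
  (`not_witnessTransfer_iff`): an unconditional refutation must PROVE the engine (rank-3 crux, open) and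
  REFUTE the hinge (rank-2 crux, open). Both trivial truth directions are recorded
  (`not_landscapeBound_of_not_witnessTransfer`, `witnessTransfer_of_not_twoReplicaTransienceBound`). WHY IT RESISTS:
  no junk model separates the two sides (§1), and the analytic content (FK semigroup = maximal form) is
  true (§5, stub C).
* §1 THE VACUITY CHANNEL, quantified. The pointwise form `PointwiseWitnessTransfer`
  (`∀ v, TwoReplicaClause v → LandscapeClause v`, which is what line `Sketch` proves, `stub_landscape_of_parts`)
  implies the crux (`witnessTransfer_of_pointwise`). Where the witness is JUNK (`‖e^{-TH}1‖₂ = 0`, so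
  `fkWitness ≡ 0` by `x/0 = 0`) the engine integrand is `0/0 = 0` and the engine clause holds for EVERY
  constant (LANDED: p99972 ACCEPTED, `Theorems/WitnessTransfer/Negative/TwoReplicaClauseOfDegenerate.lean`:
  `twoReplicaIntegrand_eq_zero_of_fkNormSq_eq_zero`, `twoReplicaClause_of_degenerate`); conversely an engine
  clause with `C < 1` FORCES degeneracy (`fkNormSq_eq_zero_of_twoReplicaClause_lt_one`, §2), whence the
  dichotomy `twoReplicaClause_lt_one_iff_degenerate` below. So the
  only cheap refutation route is an admissible `v` that is FK-degenerate at LOW density while its hinge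
  is contentful. CATALOGUE OF SINGULAR ADMISSIBLE `v` TRIED (all consistent on both sides, no separation):
  (a) `v = ⊤` on a dense Lebesgue-null set of radii — invisible to `energy` (null set in `Config`) AND to
  `pathAction` (a lower Lebesgue integral in time: the pair-distance process has a density at each fixed
  time, so the occupation time of a null set of radii is a.s. zero); (b) `v = ⊤·1_K`, `K` a fat Cantor
  set of radii — `hardVec v` is the full ball (every interval meets `K` in positive measure), a solid hard
  core on BOTH sides (occupation density / continuity); (c) finite but non-`L¹` thin shells
  `v = |r − r₁|⁻¹` (`{v = ⊤} = ∅` but `r₁ ∈ hardRad v`) — a Dirichlet wall on the sphere on BOTH sides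
  (Brownian local time at a crossed level is positive ⇒ infinite action; a continuous finite-energy `Ψ`
  vanishes on the sphere, `eq_zero_of_dist_mem_hardRad`); (d) collision-hard `v` (`∫₀ v r² dr = ∞`, e.g.
  `r⁻³`): wall at `xᵢ = xⱼ` on both sides (capacity zero, harmless for `H¹₀`); (e) `L¹_loc` but
  non-Kato singularities: no wall on either side. GENERAL REASON: by monotone convergence of the closed
  forms `h₀ + (V ∧ k) ↑ h₀ + V` (Simon 1978, canonical decomposition / monotone convergence for forms)
  the killed, weighted FK semigroup `fkSemigroup v L t` IS `e^{-tH}P` for the MAXIMAL form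
  `∫|∇u|² + ∫V|u|²` on `H¹₀(Λ^N) ∩ Q(V)`; finite-energy `TrialState`s lie in that domain with form = energy,
  so `inf σ(H_FK) ≤ E₀(C¹)` for EVERY measurable `v ≥ 0` — the transfer is true in substance; at low
  density `E₀ < ⊤` eventually (`BoseGasThermodynamicLimitRuelle`: `criticalDensity_pos`,
  `limsup_lt_top_of_small`), so `Z(T) > 0` (line stub C) and the vacuity channel is CLOSED.
* §2 TIGHTNESS (LANDED as a Negative lemma: p99189 ACCEPTED, commit d9976566dae5,
  `Theorems/WitnessTransfer/Negative/LandscapeRatioFloor.lean`, imported here): the common functional has the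
  floor `R_L(f) ≥ ‖f‖₂²` (`lintegral_sq_le_landscapeRatio`, slice Cauchy–Schwarz `s² ≤ |Λ_L| m`); every
  `TrialState` has `R_L ≥ 1` (`one_le_landscapeRatio`); the hinge clause with `C < 1` is false at every
  `(v, ρ)` (`landscapeClause_false_of_lt_one`); the non-degenerate FK witness has `R_L ≥ 1`
  (`one_le_twoReplicaRatio`). Numbers: free Dirichlet gas `(π²/8)³ = 1.8781` (route file); conjectured
  dilute value `1 + O(√(ρa³))` sits just above the floor — consistent, nothing to attack.
* §3 NATURAL STRENGTHENINGS. (S1) `LandscapeBoundAttained` (a `δ`-UNIFORM witness, i.e. an attained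
  nonnegative `C¹` minimiser with bounded ratio): FALSE already for `v = 0` (the free Dirichlet infimum
  `3(n+1)π²/L²` is not attained in the `C¹`-ambient class: strict Wirtinger) — INFORMAL, `sorry`
  (`not_landscapeBoundAttained`; obstruction: `E₀(free) = 3(n+1)π²/L²` is not in the tree). Moral for
  provers: the witness must depend on `δ` (as `T(n, δ)` does in line `Sketch`). (S2) `LandscapeBoundForAll`
  ("EVERY nonnegative `δ`-near-minimiser has ratio `≤ C`"): FALSE wherever a nonnegative near-minimiser
  exists (spike-in-a-slice: a tall thin bump `a β((x−x₀)/ℓ)χ(Y)` raises `R_L` by `≍ p K²` at energy cost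
  `≍ p K^{5/3}/L²`, `p` = slice mass touched, `K` = height ratio; take `p ≍ δ² K^{-5/3}`, `K → ∞`) —
  INFORMAL, `sorry` (`not_landscapeBoundForAll`). Moral: `R_L` is NOT `L²`/energy-continuous, only
  controlled under uniform convergence with support control (exactly the prover's
  `tendsto_lintegral_ratio`); `GroundStateRigidity` cannot convert ONE good witness into a bound for all
  near-minimisers — the route rightly does not try (its `closes` uses occupation, which IS `L²`-stable).
  (S3) same-constant transfer (`C' = C`): OPEN, not refuted by the free gas (ratio dips below `(π²/8)³`
  at `O(ε²)` energy cost along `sin + ε sin 3`). (S4) the engine's `sup_{T ≥ 1}` is dead weight for THIS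
  glue: `TwoReplicaEventualBound` (`∃ T₀, ∀ T ≥ T₀`) is all line `Sketch` consumes (one `T = T(n,δ)`);
  `twoReplicaTransienceBound_imp_eventual` (planner information, not a defect).
* §4 LOAD-BEARING HYPOTHESES: the crux has no droppable hypothesis of its own (closed implication);
  inside the clauses: nonnegativity of the hinge witness is what the FK side gives for free
  (`fkWitness_nonneg`); the `C¹`/Dirichlet/Bose requirements of `TrialState` are met by product
  mollification (`trialFn_comp_perm`); `IsRepulsiveFiniteRange` is used only through measurability
  (finite range is never used by the transfer — `witnessTransfer` would survive `v` of infinite range).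
* §5 LINE `Sketch` AUDIT (lead's stubs, file Lines/Sketch.lean as of 2026-08-16T11:30Z): NO STUB BROKEN.
  (B) `stub_heig`: true — `log Z` is midpoint-convex (Cauchy–Schwarz + semigroup law + symmetry, valid at
  `a = 0` without continuity) and antitone, hence convex; the chord/slope inequality at `0 < T < T+t/2`
  is the claim; `Z(T) ≠ 0 ⇒ Z(T') ≠ 0 ∀T'` (spectral measure of `P1`); edge `N = 0`: `1 ≤ 1`. (C)
  `stub_envelope`: true — equivalent to `inf supp μ₁ ≤ E₀(C¹)` plus discreteness (the FK semigroup is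
  Hilbert–Schmidt, dominated by the free killed kernel) plus a nonnegative ground vector (positivity);
  `c = ⟨1,Ψ₀⟩²` works; the truncation proof (`min v k ↑ v`, `⟨1,Ψ₀⁽ᵏ⁾⟩ ≥ κ⁻¹e^{-E₀}` from the uniform
  `L² → L^∞` bound) is sound. (E1a) `stub_formBound`: true — `heig` forces `PΨ = Ψ` and form `≤ E`
  (`(1 − e^{-tλ})/t ↑ λ`), the form is `∫|∇Ψ|² + ∫VΨ²` (maximal form, §1) and
  `sqIncr_t/(2t) = ⟨Ψ,(1−e^{tΔ})Ψ⟩/t ↑ ∫|∇Ψ|²`, so the bound holds for ALL `t > 0`; `E < 0` is vacuous.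
  (E1b) `stub_trialState`: true (margin `r < r₀` keeps the support in `S ⊆ Λ^N`; `∫V(ρ_r∗f)² → ∫Vf²` by
  dominated convergence against `M²V𝟙_S ∈ L¹`; `hev` gives `f ∈ H¹`, mollification lowers the Dirichlet
  integral). (F) `stub_ratio_mollify`: true, and in fact EXACTLY monotone, `R_L(ρ_r ∗ f) ≤ R_L(f)` for
  every `r > 0` (the slice functional `(∫h²)²/(∫h)²` is the square of a perspective functional, hence
  convex; the product mollifier makes the mollified slice a probability average of `x`-mollified slices;
  Jensen + Young) — the `ε`, the `∃ᶠ` and the new margin hypothesis are slack (INFORMAL here,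
  `landscapeRatio_mollify_le`, not a target). (E2) `stub_vanish`: true for every admissible `v` (solid
  cores: regular boundary; thin non-`L¹` shells: positive local time at a crossed level; collision-hard
  `v`: action `≳ τ/|w₀|` at scale `|w₀|`; tiny gaps of `hardRad`: confinement cost) but needs Brownian
  local time / occupation densities — the honest residual, as the lead says. Its NAIVE variant with
  `{z | v ‖z‖ = ⊤}` in place of `hardVec v` is FALSE (case (a): `v = ⊤` on rational radii is the free
  gas for `fkSemigroup`, yet every configuration is near a "hard" sphere) — recorded so nobody restates
  (E2) over `{v = ⊤}`. (G) bookkeeping checked: `R_L(cf) = c²R_L(f)` (degree 2, NOT scale-free — the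
  normalising constant of `c·ρ_r∗(Ψ_T−η)₊` must be tracked, and it is: `c² ≤ 1+ε`); truncation
  `(Ψ_T−η)₊ → Ψ_T` uniformly with the domination `L³‖Ψ_T‖∞²` on a finite box.

## What would change the verdict
* A proof that some admissible `v` has `inf σ(H_FK) < E₀(C¹)` strictly at low density (maximal ≠ minimal
  form for a pair-potential sum) would break line `Sketch` at (C)/(G) and make the crux false in spirit
  (the FK witnesses would then under-shoot the `C¹` infimum); §1's argument says this cannot happen.
* `¬ LandscapeBound` (the hinge) for some admissible `v` together with the engine — out of reach.
-/

noncomputable section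

open MeasureTheory Filter Set Metric
open scoped ENNReal NNReal Topology

namespace Summit.AtomisticToContinuum.BoseEinsteinCondensation.Cruxes.WitnessTransfer.Disproof

open Literature.MathematicalPhysics.QuantumManyBody.BoseGas
open Summit.AtomisticToContinuum.BoseEinsteinCondensation.Theses.BECCutLineWeakDisorder

variable {n : ℕ}

/-! ## §0 Shape of the crux and why a refutation is out of reach -/

/-- The crux is the implication engine → hinge, by `Iff.rfl`. [folklore] -/
theorem witnessTransfer_iff : WitnessTransfer ↔ (TwoReplicaTransienceBound → LandscapeBound) := Iff.rfl

/-- **What a refutation must do**: `¬ WitnessTransfer ↔ TwoReplicaTransienceBound ∧ ¬ LandscapeBound`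
— prove the engine AND refute the hinge (both open cruxes of the route). [folklore] -/
theorem not_witnessTransfer_iff :
    ¬ WitnessTransfer ↔ (TwoReplicaTransienceBound ∧ ¬ LandscapeBound) := Classical.not_imp

/-- Trivial truth direction 1: the hinge alone gives the crux (kept as an `example`, so that no
declaration of this ADVERSARIAL file is mistaken for a proof of the item modulo the registered hinge). -/
example (h : LandscapeBound) : WitnessTransfer := fun _ => h

/-- The same direction, contrapositive (citable form): a refutation of the crux refutes the hinge.
[folklore] -/
theorem not_landscapeBound_of_not_witnessTransfer (h : ¬ WitnessTransfer) : ¬ LandscapeBound :=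
  fun hL => h fun _ => hL

/-- Trivial truth direction 2: a refutation of the engine gives the crux (and kills the route's
`closes`, which needs the engine as `hT`). [folklore] -/
theorem witnessTransfer_of_not_twoReplicaTransienceBound (h : ¬ TwoReplicaTransienceBound) :
    WitnessTransfer := fun hT => (h hT).elim

/-! ## §1 The pointwise form and the vacuity channel -/

/-- The engine clause of `TwoReplicaTransienceBound` at the potential `v` (verbatim). -/
def TwoReplicaClause (v : ℝ → ℝ≥0∞) : Prop :=
  ∃ ρ₀ : ℝ, 0 < ρ₀ ∧ ∀ ρ : ℝ, 0 < ρ → ρ < ρ₀ → ∃ C : ℝ, 0 < C ∧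
    ∀ᶠ n : ℕ in Filter.atTop, ∀ T : ℝ, 1 ≤ T →
      ∫⁻ Y : Config n, ENNReal.ofReal (sideLength ρ (n + 1) ^ 3) *
          (∫⁻ x, (‖fkWitness (N := n + 1) v (sideLength ρ (n + 1)) T (fun _ => (1 : ENNReal))
            (Matrix.vecCons x Y)‖₊ : ENNReal) ^ 2) ^ 2 /
          (∫⁻ x, (‖fkWitness (N := n + 1) v (sideLength ρ (n + 1)) T (fun _ => (1 : ENNReal))
            (Matrix.vecCons x Y)‖₊ : ENNReal)) ^ 2 ≤ ENNReal.ofReal C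

/-- The hinge clause of `LandscapeBound` at the potential `v` (verbatim). -/
def LandscapeClause (v : ℝ → ℝ≥0∞) : Prop :=
  ∃ ρ₀ : ℝ, 0 < ρ₀ ∧ ∀ ρ : ℝ, 0 < ρ → ρ < ρ₀ → ∃ C : ℝ, 0 < C ∧
    ∀ᶠ n : ℕ in Filter.atTop, ∀ δ : ENNReal, 0 < δ →
      ∃ Ψ : TrialState (n + 1) (sideLength ρ (n + 1)),
        energy v Ψ ≤ groundStateEnergy v (n + 1) (sideLength ρ (n + 1)) + δ ∧
        (∀ X, Ψ.ψ X = (‖Ψ.ψ X‖ : ℂ)) ∧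
        ∫⁻ Y : Config n, ENNReal.ofReal (sideLength ρ (n + 1) ^ 3) *
            (∫⁻ x, (‖Ψ.ψ (Matrix.vecCons x Y)‖₊ : ENNReal) ^ 2) ^ 2 /
              (∫⁻ x, (‖Ψ.ψ (Matrix.vecCons x Y)‖₊ : ENNReal)) ^ 2 ≤ ENNReal.ofReal C

/-- The engine, potential by potential. [folklore] -/
theorem twoReplicaTransienceBound_iff :
    TwoReplicaTransienceBound ↔ ∀ v : ℝ → ℝ≥0∞, IsRepulsiveFiniteRange v → TwoReplicaClause v :=
  Iff.rfl

/-- The hinge, potential by potential. [folklore] -/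
theorem landscapeBound_iff :
    LandscapeBound ↔ ∀ v : ℝ → ℝ≥0∞, IsRepulsiveFiniteRange v → LandscapeClause v :=
  Iff.rfl

/-- The POINTWISE transfer (what line `Sketch` proves: `stub_landscape_of_parts` is this, `v` by `v`). -/
def PointwiseWitnessTransfer : Prop :=
  ∀ v : ℝ → ℝ≥0∞, IsRepulsiveFiniteRange v → TwoReplicaClause v → LandscapeClause v

/-- The pointwise transfer implies the crux (the converse is not claimed: the crux may in principle
use the engine at OTHER potentials; no such use is known). [folklore] -/
theorem witnessTransfer_of_pointwise (h : PointwiseWitnessTransfer) : WitnessTransfer :=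
  fun hT v hv => h v hv (hT v hv)

/-! The vacuity channel, formally — LANDED (p99972 ACCEPTED) as
`Theorems/WitnessTransfer/Negative/TwoReplicaClauseOfDegenerate.lean`, namespace
`Summit.AtomisticToContinuum.BoseEinsteinCondensation.Theorems.WitnessTransfer.Negative`, with the SAME three
names as the local copies kept below (the farm had not built that module when this file was published;
a later cycle replaces the copies by the import). -/

/-- **The junk witness.** If `‖e^{-TH}1‖₂² = 0` then `fkWitness v L T 1 ≡ 0` (`x / √0 = x / 0 = 0`).
[folklore] -/
theorem fkWitness_eq_zero_of_fkNormSq_eq_zero {N : ℕ} (v : ℝ → ℝ≥0∞) (L T : ℝ)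
    (h : fkNormSq (N := N) v L T (fun _ => 1) = 0) (X : Config N) :
    fkWitness (N := N) v L T (fun _ => 1) X = 0 := by
  simp [fkWitness_apply, h]

/-- **The vacuity channel, slice by slice**: for the junk witness the engine integrand is `0/0 = 0`.
[folklore] -/
theorem twoReplicaIntegrand_eq_zero_of_fkNormSq_eq_zero {v : ℝ → ℝ≥0∞} {L T : ℝ}
    (h : fkNormSq (N := n + 1) v L T (fun _ => 1) = 0) (Y : Config n) :
    ENNReal.ofReal (L ^ 3) *
        (∫⁻ x, (‖fkWitness (N := n + 1) v L T (fun _ => (1 : ℝ≥0∞)) (Matrix.vecCons x Y)‖₊ :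
          ℝ≥0∞) ^ 2) ^ 2 /
        (∫⁻ x, (‖fkWitness (N := n + 1) v L T (fun _ => (1 : ℝ≥0∞)) (Matrix.vecCons x Y)‖₊ :
          ℝ≥0∞)) ^ 2 = 0 := by
  simp [fkWitness_eq_zero_of_fkNormSq_eq_zero v L T h]

/-- **The engine clause is FREE wherever the witness is junk**: if eventually in `n` the witnesses are
degenerate for all `T ≥ 1`, the engine inequality holds with EVERY constant `C` (even `C ≤ 0`).
[folklore] -/
theorem twoReplicaClause_of_degenerate {v : ℝ → ℝ≥0∞} {ρ : ℝ}
    (h : ∀ᶠ n : ℕ in Filter.atTop, ∀ T : ℝ, 1 ≤ T →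
      fkNormSq (N := n + 1) v (sideLength ρ (n + 1)) T (fun _ => 1) = 0) (C : ℝ) :
    ∀ᶠ n : ℕ in Filter.atTop, ∀ T : ℝ, 1 ≤ T →
      ∫⁻ Y : Config n, ENNReal.ofReal (sideLength ρ (n + 1) ^ 3) *
          (∫⁻ x, (‖fkWitness (N := n + 1) v (sideLength ρ (n + 1)) T (fun _ => (1 : ENNReal))
            (Matrix.vecCons x Y)‖₊ : ENNReal) ^ 2) ^ 2 /
          (∫⁻ x, (‖fkWitness (N := n + 1) v (sideLength ρ (n + 1)) T (fun _ => (1 : ENNReal))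
            (Matrix.vecCons x Y)‖₊ : ENNReal)) ^ 2 ≤ ENNReal.ofReal C := by
  filter_upwards [h] with n hn T hT
  simp [twoReplicaIntegrand_eq_zero_of_fkNormSq_eq_zero (hn T hT)]

/-! ## §2 Tightness: the floor `R_L(f) ≥ ‖f‖₂²` — LANDED (p99189, commit d9976566dae5) as
`Theorems/WitnessTransfer/Negative/LandscapeRatioFloor.lean`, namespace
`Summit.AtomisticToContinuum.BoseEinsteinCondensation.Theorems.WitnessTransfer.Negative`, imported above:
`lintegral_sq_le_landscapeRatio` (the floor), `one_le_landscapeRatio` (trial states),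
`landscapeClause_false_of_lt_one`, `not_landscapeBound_with_constant_lt_one` (hinge constant `< 1` is
impossible), `one_le_twoReplicaRatio` (non-degenerate FK witness), `fkNormSq_eq_zero_of_twoReplicaClause_lt_one`
(engine constant `< 1` forces the junk witness). Two corollaries in the vocabulary of §1: -/

/-- The hinge clause at `v` can never be witnessed with a constant `< 1`: `LandscapeClause v` with its
`∃ C, 0 < C ∧ …` sharpened to `∃ C, C < 1 ∧ …` is false for EVERY `v`. [folklore] -/
theorem not_landscapeClause_lt_one (v : ℝ → ℝ≥0∞) :
    ¬ (∃ ρ₀ : ℝ, 0 < ρ₀ ∧ ∀ ρ : ℝ, 0 < ρ → ρ < ρ₀ → ∃ C : ℝ, C < 1 ∧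
      ∀ᶠ n : ℕ in Filter.atTop, ∀ δ : ENNReal, 0 < δ →
        ∃ Ψ : TrialState (n + 1) (sideLength ρ (n + 1)),
          energy v Ψ ≤ groundStateEnergy v (n + 1) (sideLength ρ (n + 1)) + δ ∧
          (∀ X, Ψ.ψ X = (‖Ψ.ψ X‖ : ℂ)) ∧
          ∫⁻ Y : Config n, ENNReal.ofReal (sideLength ρ (n + 1) ^ 3) *
              (∫⁻ x, (‖Ψ.ψ (Matrix.vecCons x Y)‖₊ : ENNReal) ^ 2) ^ 2 /
                (∫⁻ x, (‖Ψ.ψ (Matrix.vecCons x Y)‖₊ : ENNReal)) ^ 2 ≤ ENNReal.ofReal C) := by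
  rintro ⟨ρ₀, hρ₀, h⟩
  obtain ⟨C, hC, hcl⟩ := h (ρ₀ / 2) (by positivity) (by linarith)
  exact Theorems.WitnessTransfer.Negative.landscapeClause_false_of_lt_one hC hcl

/-- **The junk dichotomy of the engine at constants below the floor**: for measurable `v`, the engine
inequality at `(v, ρ)` with a constant `C < 1` holds iff the witnesses are eventually degenerate
(`‖e^{-TH}1‖₂ = 0` for all `T ≥ 1`). [folklore] -/
theorem twoReplicaClause_lt_one_iff_degenerate {v : ℝ → ℝ≥0∞} (hv : Measurable v) {ρ C : ℝ}
    (hC : C < 1) :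
    (∀ᶠ n : ℕ in Filter.atTop, ∀ T : ℝ, 1 ≤ T →
      ∫⁻ Y : Config n, ENNReal.ofReal (sideLength ρ (n + 1) ^ 3) *
          (∫⁻ x, (‖fkWitness (N := n + 1) v (sideLength ρ (n + 1)) T (fun _ => (1 : ENNReal))
            (Matrix.vecCons x Y)‖₊ : ENNReal) ^ 2) ^ 2 /
          (∫⁻ x, (‖fkWitness (N := n + 1) v (sideLength ρ (n + 1)) T (fun _ => (1 : ENNReal))
            (Matrix.vecCons x Y)‖₊ : ENNReal)) ^ 2 ≤ ENNReal.ofReal C) ↔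
    (∀ᶠ n : ℕ in Filter.atTop, ∀ T : ℝ, 1 ≤ T →
      fkNormSq (N := n + 1) v (sideLength ρ (n + 1)) T (fun _ => 1) = 0) :=
  ⟨Theorems.WitnessTransfer.Negative.fkNormSq_eq_zero_of_twoReplicaClause_lt_one hv hC,
    fun h => twoReplicaClause_of_degenerate h C⟩

/-! ## §3 Natural strengthenings -/

/-- (S1) The hinge with a `δ`-UNIFORM witness: an attained nonnegative `C¹` minimiser of bounded ratio
(`energy v Ψ ≤ E₀`, i.e. `= E₀`; everything else verbatim). -/
def LandscapeBoundAttained : Prop :=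
  ∀ v : ℝ → ℝ≥0∞, IsRepulsiveFiniteRange v → ∃ ρ₀ : ℝ, 0 < ρ₀ ∧ ∀ ρ : ℝ, 0 < ρ → ρ < ρ₀ →
    ∃ C : ℝ, 0 < C ∧ ∀ᶠ n : ℕ in Filter.atTop,
      ∃ Ψ : TrialState (n + 1) (sideLength ρ (n + 1)),
        energy v Ψ ≤ groundStateEnergy v (n + 1) (sideLength ρ (n + 1)) ∧
        (∀ X, Ψ.ψ X = (‖Ψ.ψ X‖ : ℂ)) ∧
        ∫⁻ Y : Config n, ENNReal.ofReal (sideLength ρ (n + 1) ^ 3) *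
            (∫⁻ x, (‖Ψ.ψ (Matrix.vecCons x Y)‖₊ : ENNReal) ^ 2) ^ 2 /
              (∫⁻ x, (‖Ψ.ψ (Matrix.vecCons x Y)‖₊ : ENNReal)) ^ 2 ≤ ENNReal.ofReal C

/-- (S1) trivially implies the hinge (so it is a genuine strengthening). [folklore] -/
theorem landscapeBound_of_attained (h : LandscapeBoundAttained) : LandscapeBound := by
  intro v hv
  obtain ⟨ρ₀, hρ₀, H⟩ := h v hv
  refine ⟨ρ₀, hρ₀, fun ρ hρ hρ' => ?_⟩
  obtain ⟨C, hC, hev⟩ := H ρ hρ hρ'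
  refine ⟨C, hC, ?_⟩
  filter_upwards [hev] with n ⟨Ψ, hE, hre, hR⟩ δ _
  exact ⟨Ψ, hE.trans le_self_add, hre, hR⟩

/-- **(S1) is FALSE — INFORMAL (near-miss of a formal refutation of the strengthening).** Witness:
the free gas `v = 0` (admissible). CLAIM: for `N ≥ 1`, `L > 0` no `Ψ ∈ TrialState N L` attains
`groundStateEnergy 0 N L`: (i) `E₀(free) = 3Nπ²/L²` (upper bound by the explicit `C¹` products
`∏ u_J(x_{ik})`, `u_J(θ) = sin θ − J⁻¹∑_{j ≤ J} sin((2j+1)θ)/(2j+1)`, whose Rayleigh quotients tend to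
`(π/L)²` and which ARE `C¹` across the wall since `u_J'(0) = u_J'(π) = 0`; lower bound by Wirtinger on
each coordinate line); (ii) strictness: a `C¹`-ambient function vanishing outside `(0, L)` with
`∫|u'|² = (π/L)²∫|u|²` is `c·sin(π·/L)`, which is `C¹` across the wall only for `c = 0`. OBSTRUCTION to
formalising here: neither bound of (i) is in the tree (`BoseGasFreeDirichletBEC` works with occupations,
not with the value of `E₀`); estimated cost several hundred lines of one-dimensional calculus. MORAL
(provers): the hinge witness must depend on `δ`; line `Sketch` complies (`T = T(n, δ)`). [folklore] -/
theorem not_landscapeBoundAttained : ¬ LandscapeBoundAttained := by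
  sorry

/-- (S2) The hinge for ALL near-minimisers: some `δ > 0` such that EVERY nonnegative `δ`-near-minimiser
has ratio `≤ C` (the "uniform" reading a rigidity argument would need). -/
def LandscapeBoundForAll : Prop :=
  ∀ v : ℝ → ℝ≥0∞, IsRepulsiveFiniteRange v → ∃ ρ₀ : ℝ, 0 < ρ₀ ∧ ∀ ρ : ℝ, 0 < ρ → ρ < ρ₀ →
    ∃ C : ℝ, 0 < C ∧ ∀ᶠ n : ℕ in Filter.atTop, ∃ δ : ENNReal, 0 < δ ∧
      ∀ Ψ : TrialState (n + 1) (sideLength ρ (n + 1)),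
        energy v Ψ ≤ groundStateEnergy v (n + 1) (sideLength ρ (n + 1)) + δ →
        (∀ X, Ψ.ψ X = (‖Ψ.ψ X‖ : ℂ)) →
        ∫⁻ Y : Config n, ENNReal.ofReal (sideLength ρ (n + 1) ^ 3) *
            (∫⁻ x, (‖Ψ.ψ (Matrix.vecCons x Y)‖₊ : ENNReal) ^ 2) ^ 2 /
              (∫⁻ x, (‖Ψ.ψ (Matrix.vecCons x Y)‖₊ : ENNReal)) ^ 2 ≤ ENNReal.ofReal C

/-- **(S2) is FALSE — INFORMAL.** Witness again `v = 0` (any `v` with a nonnegative near-minimiser at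
hand would do): given a nonnegative `δ/2`-near-minimiser `Ψ` and a slice region `B ⊂ Config n` of
`Ψ²`-mass `p` around a well-separated `Y₀`, the state `Ψ' = (Ψ + a·β((x−x₀)/ℓ)·χ_B(Y))/‖·‖` with
`a = K·(mean slice height)`, `ℓ³ = L³/(K c₁)` is nonnegative, `C¹`, Bose-symmetric after symmetrisation
in the tagged variable (or: place the bump symmetrically), has energy
`≤ (√(E₀ + δ/2) + √E_φ)²`, `E_φ ≍ p K^{5/3}/L²`, and ratio `≳ p K²`; with `p ≍ δ²K^{-5/3}L²/E₀` the
energy stays `≤ E₀ + δ` while the ratio `≍ δ² K^{1/3} L²/E₀ → ∞` (`K → ∞`, `n, L, δ` fixed).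
OBSTRUCTION: explicit `C¹` states on `(ℝ³)^{n+1}` with energy bookkeeping (and `E₀(free)`) — out of
scope for a cycle. MORAL (provers/planner): `R_L` is not energy- or `L²`-continuous; only uniform
convergence with support control moves it (the prover's `tendsto_lintegral_ratio`), and no rigidity
statement upgrades ONE good witness to all near-minimisers — which the route, correctly, never needs
(`closes` transports OCCUPATION, which is `L²`-Lipschitz, not the ratio). [folklore] -/
theorem not_landscapeBoundForAll : ¬ LandscapeBoundForAll := by
  sorry

/-- (S4) The engine with `sup_{T ≥ 1}` weakened to "for all large `T`" (`∃ T₀, ∀ T ≥ T₀`, per `n`). -/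
def TwoReplicaEventualBound : Prop :=
  ∀ v : ℝ → ℝ≥0∞, IsRepulsiveFiniteRange v → ∃ ρ₀ : ℝ, 0 < ρ₀ ∧ ∀ ρ : ℝ, 0 < ρ → ρ < ρ₀ →
    ∃ C : ℝ, 0 < C ∧ ∀ᶠ n : ℕ in Filter.atTop, ∃ T₀ : ℝ, ∀ T : ℝ, T₀ ≤ T →
      ∫⁻ Y : Config n, ENNReal.ofReal (sideLength ρ (n + 1) ^ 3) *
          (∫⁻ x, (‖fkWitness (N := n + 1) v (sideLength ρ (n + 1)) T (fun _ => (1 : ENNReal))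
            (Matrix.vecCons x Y)‖₊ : ENNReal) ^ 2) ^ 2 /
          (∫⁻ x, (‖fkWitness (N := n + 1) v (sideLength ρ (n + 1)) T (fun _ => (1 : ENNReal))
            (Matrix.vecCons x Y)‖₊ : ENNReal)) ^ 2 ≤ ENNReal.ofReal C

/-- The engine implies its eventual form (trivially, `T₀ = 1`). Planner information: line `Sketch`
consumes the engine at ONE `T = T(n, δ)` that may be taken arbitrarily large, so
`TwoReplicaEventualBound → LandscapeBound` is what is really being proved; the `sup` over `T ∈ [1, T₀]`
in the engine is dead weight for this glue (it matters only for uniform-in-`T` readings). [folklore] -/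
theorem twoReplicaTransienceBound_imp_eventual (h : TwoReplicaTransienceBound) :
    TwoReplicaEventualBound := by
  intro v hv
  obtain ⟨ρ₀, hρ₀, H⟩ := h v hv
  refine ⟨ρ₀, hρ₀, fun ρ hρ hρ' => ?_⟩
  obtain ⟨C, hC, hev⟩ := H ρ hρ hρ'
  refine ⟨C, hC, ?_⟩
  filter_upwards [hev] with n hn
  exact ⟨1, hn⟩

/-! ## §5 Line `Sketch`: the one informal positive remark worth recording formally -/

/-- **(F) holds EXACTLY — INFORMAL, NOT A TARGET.** For the product mollifier of the library the
landscape functional is non-increasing under mollification with NO error term: the slice functional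
`Φ(h) = (∫h²)²/(∫h)²` on the nonnegative cone is the square of the perspective functional `‖h‖₂²/‖h‖₁`,
hence convex; `(ρ_r ∗ f)(·, Y) = ∫ ρ^{bath}_r(Y − Y') [β_r ∗ₓ f(·, Y')] dY'` is a probability average,
so Jensen (two Cauchy–Schwarz steps, valid with `0/0 = 0`) and Tonelli give
`R_L(ρ_r ∗ f) ≤ ∫ Φ(β_r ∗ₓ f(·,Y')) dY' ≤ R_L(f)` (Young: `‖β∗g‖₂ ≤ ‖g‖₂`, `‖β∗g‖₁ = ‖g‖₁` for `g ≥ 0`).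
Recorded here only so that nobody spends an attack on `stub_ratio_mollify` (its `ε`, `∃ᶠ` and margin
hypothesis are slack); statement kept informal (the tree's `mollify` signature is the lead's business). -/
theorem landscapeRatio_mollify_le_informal : True := trivial

end Summit.AtomisticToContinuum.BoseEinsteinCondensation.Cruxes.WitnessTransfer.Disproof

end
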